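import Summits.PneNP.PneNP.Theorems.ChebyshevTracialDesignTiltedSmallBlockTools
import Literature.Combinatorics.Optimization.ShellLawHalfPinningTwo
import HarnessLib

/-!
# Cell pnp-psdrank, route `ChebyshevTracialDesign`: TILTED JUNTAS ON A SMALL BLOCK — tools (brick J1 = 162a; crux `TracialDecayExp20`,
# stmt-PneNP-19878)

Brick 162a (prover g31; MEMO-34 §6). The junta companion of bricks 151a/158a. On a `π`-stable ground set `S`, a block `H` and VERTEX-DEPENDENT
tilt coefficients `α_v` (`v ∈ S ∩ H`), the tilted junta integrand is `f(U∩H)·(A(U∩H) − Σ_{v∈S∩H} α_vY_v + L − κc)²` with `Y_v = [v ∈ half U]`: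
* §1 `wHalf_sq_eq` — `(Σ_v α_vY_v)² = Σ_v α_v²Y_v + Σ_{v}Σ_{w ∉ e_v} α_vα_wY_vY_w` (for `U ⊆ S`, a half-matched vertex has an unmatched partner).
* §2 WEIGHTED half-pinning sums and averages of a general cut function: `sum_shellIn_wHalf_mul_eq` / `shellInAvg_wHalf_mul_eq`
  (`Σ_U (Σ_v α_vY_v)g(U) = Σ_{v∈S∩H} α_v Σ_{W∈Shell_{S∖e_v}} g(W+v)`, lit `sum_shellIn_half_eq` vertex by vertex) and the pair form
  `sum_shellIn_wHalfPairs_mul_eq` / `shellInAvg_wHalfPairs_mul_eq` (two half-matched vertices on different edges pinned, lit `sum_shellIn_half_half_eq`),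
  with their junta all-level forms `avg_wHalf_junta_eq`, `avg_wHalfPairs_junta_eq` (the pinned mask is the junta `J ↦ Φ(insert v J)` of the in-set of the
  smaller ground set; `insert_inter_of_mem'`).
WHAT THIS FILE DOES NOT DO: the seven-term expansion (162b), the assembly (162c). [cite: Rothvoss2017, §2 (PDF p. 6)] [cite: RollinRoss2010, §3 (Lemma 3.1)]
Stature: support/instrument (kernel lane, no defs, axioms standard). WHAT THIS IS NOT: nothing on spread / non-junta masks (the open heart, N2), no proof or refutation of
`TracialDecayExp20`, nothing on psd rank of P_PM(K_n), no P-vs-NP content. Supports stmt-PneNP-19878.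
-/

set_option linter.dupNamespace false -- `Summit.PneNP.PneNP.…`: summit = sub-problem (D-0017)

noncomputable section

namespace Summit.PneNP.PneNP.Theorems.ChebyshevTracialDesignTiltedJuntaTools

open Finset Literature.Barriers.PneNP Literature.Combinatorics.Optimization
open Literature.Combinatorics.Optimization.ShellStep

variable {n : ℕ}

/-! ### §1 The square of a weighted half count -/

/-- **The square of a weighted half count.** For `U ⊆ S` (so that a half-matched vertex has its partner unmatched):
`(Σ_{v∈S∩H} α_v[v ∈ half U])² = Σ_{v∈S∩H} α_v²[v ∈ half U] + Σ_{v∈S∩H} Σ_{w∈(S∩H)∖e_v} α_vα_w[v ∈ half U][w ∈ half U]`.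
[cite: Rothvoss2017, §2 (PDF p. 5)] -/
theorem wHalf_sq_eq {π : Fin n → Fin n} (S H U : Finset (Fin n)) (α : Fin n → ℝ) :
    (∑ v ∈ S ∩ H, α v * (if (v ∈ U ∧ π v ∉ U) then (1 : ℝ) else 0)) ^ 2 =
      (∑ v ∈ S ∩ H, α v ^ 2 * (if (v ∈ U ∧ π v ∉ U) then (1 : ℝ) else 0)) +
        ∑ v ∈ S ∩ H, ∑ w ∈ (S ∩ H) \ {v, π v},
          α v * α w * ((if (v ∈ U ∧ π v ∉ U) then (1 : ℝ) else 0) * (if (w ∈ U ∧ π w ∉ U) then (1 : ℝ) else 0)) := by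
  classical
  rw [sq, sum_mul_sum, ← sum_add_distrib]
  refine sum_congr rfl fun v hv => ?_
  -- split the inner sum at `w = v` and drop `w = π v`
  by_cases hvh : v ∈ U ∧ π v ∉ U
  · rw [if_pos hvh]
    have hπv : ¬ (π v ∈ U ∧ π (π v) ∉ U) := fun h => hvh.2 h.1
    have e : ∑ w ∈ S ∩ H, α v * 1 * (α w * (if (w ∈ U ∧ π w ∉ U) then (1 : ℝ) else 0)) =
        α v ^ 2 * 1 + ∑ w ∈ (S ∩ H) \ {v, π v}, α v * α w * (1 * (if (w ∈ U ∧ π w ∉ U) then (1 : ℝ) else 0)) := by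
      rw [← Finset.sum_sdiff (show ({v, π v} ∩ (S ∩ H)) ⊆ S ∩ H from inter_subset_right)]
      have hsd : (S ∩ H) \ ({v, π v} ∩ (S ∩ H)) = (S ∩ H) \ {v, π v} := by
        ext w; simp only [mem_sdiff, mem_inter, mem_insert, mem_singleton]; tauto
      rw [hsd]
      have hin : ∑ w ∈ {v, π v} ∩ (S ∩ H), α v * 1 * (α w * (if (w ∈ U ∧ π w ∉ U) then (1 : ℝ) else 0)) = α v ^ 2 * 1 := by
        rw [← sum_filter_add_sum_filter_not _ (fun w => w = v)]
        have h1 : ({v, π v} ∩ (S ∩ H)).filter (fun w => w = v) = {v} := by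
          ext w; simp only [mem_filter, mem_inter, mem_insert, mem_singleton]
          constructor
          · rintro ⟨_, rfl⟩; rfl
          · rintro rfl; exact ⟨⟨Or.inl rfl, mem_inter.1 hv⟩, rfl⟩
        have h2 : ∑ w ∈ ({v, π v} ∩ (S ∩ H)).filter (fun w => ¬ w = v),
            α v * 1 * (α w * (if (w ∈ U ∧ π w ∉ U) then (1 : ℝ) else 0)) = 0 := by
          refine sum_eq_zero fun w hw => ?_
          simp only [mem_filter, mem_inter, mem_insert, mem_singleton] at hw
          obtain ⟨⟨hw1, _⟩, hw2⟩ := hw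
          rcases hw1 with rfl | rfl
          · exact absurd rfl hw2
          · rw [if_neg hπv]; ring
        rw [h1, h2, sum_singleton, if_pos hvh]; ring
      rw [hin, add_comm]
      congr 1
      exact sum_congr rfl fun w _ => by ring
    rw [e]
  · rw [if_neg hvh]
    simp

/-! ### §2 Weighted half-pinning sums and averages -/

section HalfAvg

variable {π : Fin n → Fin n} (hπ : ∀ v, π (π v) = v) (hπ' : ∀ v, π v ≠ v)
include hπ hπ'

/-- **Weighted half-count sums split over the pinned vertex**:
`Σ_{U∈Shell_S(t+1,c+1)} (Σ_{v∈S∩H} α_v[v ∈ half U])·g(U) = Σ_{v∈S∩H} α_v·Σ_{W∈Shell_{S∖e_v}(t,c)} g(W+v)`.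
[cite: Rothvoss2017, §2 (PDF p. 6)] -/
theorem sum_shellIn_wHalf_mul_eq (S H : Finset (Fin n)) (t c : ℕ) (α : Fin n → ℝ) (g : Finset (Fin n) → ℝ) :
    ∑ U ∈ shellIn π S (t + 1) (c + 1), (∑ v ∈ S ∩ H, α v * (if (v ∈ U ∧ π v ∉ U) then (1 : ℝ) else 0)) * g U =
      ∑ v ∈ S ∩ H, α v * ∑ W ∈ shellIn π (S \ {v, π v}) t c, g (insert v W) := by
  calc ∑ U ∈ shellIn π S (t + 1) (c + 1), (∑ v ∈ S ∩ H, α v * (if (v ∈ U ∧ π v ∉ U) then (1 : ℝ) else 0)) * g U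
      = ∑ U ∈ shellIn π S (t + 1) (c + 1), ∑ v ∈ S ∩ H, α v * ((if (v ∈ U ∧ π v ∉ U) then (1 : ℝ) else 0) * g U) := by
        refine sum_congr rfl fun U _ => ?_
        rw [sum_mul]
        exact sum_congr rfl fun v _ => by ring
    _ = ∑ v ∈ S ∩ H, ∑ U ∈ shellIn π S (t + 1) (c + 1), α v * ((if (v ∈ U ∧ π v ∉ U) then (1 : ℝ) else 0) * g U) :=
        sum_comm
    _ = _ := by
        refine sum_congr rfl fun v hv => ?_
        rw [← mul_sum, ← sum_shellIn_half_eq hπ hπ' (mem_inter.1 hv).1 t c g, sum_filter]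
        congr 1
        refine sum_congr rfl fun U _ => ?_
        split_ifs <;> simp

/-- **Weighted half-count average**: for a stable `S` and `Shell_S(t+1,c+1) ≠ ∅`,
`E_{Shell_S(t+1,c+1)}[(Σ_v α_v[v ∈ half U])·g(U)] = ((c+1)/|S|)·Σ_{v∈S∩H} α_v·E_{Shell_{S∖e_v}(t,c)}[g(W+v)]`. [cite: Rothvoss2017, §2 (PDF p. 6)] -/
theorem shellInAvg_wHalf_mul_eq {S : Finset (Fin n)} (hS : ∀ u ∈ S, π u ∈ S) (H : Finset (Fin n)) (t c : ℕ) (α : Fin n → ℝ)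
    (g : Finset (Fin n) → ℝ) (hne : (shellIn π S (t + 1) (c + 1)).Nonempty) :
    (∑ U ∈ shellIn π S (t + 1) (c + 1), (∑ v ∈ S ∩ H, α v * (if (v ∈ U ∧ π v ∉ U) then (1 : ℝ) else 0)) * g U) /
        ((shellIn π S (t + 1) (c + 1)).card : ℝ) =
      (((c : ℝ) + 1) / (S.card : ℝ)) * ∑ v ∈ S ∩ H,
        α v * ((∑ W ∈ shellIn π (S \ {v, π v}) t c, g (insert v W)) / ((shellIn π (S \ {v, π v}) t c).card : ℝ)) := by
  rw [sum_shellIn_wHalf_mul_eq hπ hπ' S H t c α g, sum_div, mul_sum]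
  refine sum_congr rfl fun v hv => ?_
  have hvS : v ∈ S := (mem_inter.1 hv).1
  have hr := card_shellIn_sdiff_pair_half_ratio hπ hπ' hS hvS t c
  have hA : (0 : ℝ) < (shellIn π S (t + 1) (c + 1)).card := by exact_mod_cast hne.card_pos
  have hB : (0 : ℝ) < (shellIn π (S \ {v, π v}) t c).card := by
    exact_mod_cast (shellIn_sdiff_pair_nonempty_of_half hπ hπ' hS hvS hne).card_pos
  have hSpos : (0 : ℝ) < S.card := by exact_mod_cast card_pos.2 ⟨v, hvS⟩
  have key : (∑ W ∈ shellIn π (S \ {v, π v}) t c, g (insert v W)) / ((shellIn π S (t + 1) (c + 1)).card : ℝ) =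
      (((c : ℝ) + 1) / (S.card : ℝ)) *
        ((∑ W ∈ shellIn π (S \ {v, π v}) t c, g (insert v W)) / ((shellIn π (S \ {v, π v}) t c).card : ℝ)) := by
    rw [div_mul_div_comm, div_eq_div_iff hA.ne' (mul_ne_zero hSpos.ne' hB.ne')]
    linear_combination (∑ W ∈ shellIn π (S \ {v, π v}) t c, g (insert v W)) * hr
  rw [mul_div_assoc, key]
  ring

/-- **Weighted half-pair sums split over the pinned pair**:
`Σ_{U∈Shell_S(t+2,c+2)} (Σ_vΣ_{w∈(S∩H)∖e_v} α_vα_w[v half][w half])·g(U) = Σ_vΣ_w α_vα_w·Σ_{W∈Shell_{S∖e_v∖e_w}(t,c)} g(W+w+v)`.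
[cite: Rothvoss2017, §2 (PDF p. 6)] -/
theorem sum_shellIn_wHalfPairs_mul_eq (S H : Finset (Fin n)) (t c : ℕ) (α : Fin n → ℝ) (g : Finset (Fin n) → ℝ) :
    ∑ U ∈ shellIn π S (t + 2) (c + 2), (∑ v ∈ S ∩ H, ∑ w ∈ (S ∩ H) \ {v, π v},
        α v * α w * ((if (v ∈ U ∧ π v ∉ U) then (1 : ℝ) else 0) * (if (w ∈ U ∧ π w ∉ U) then (1 : ℝ) else 0))) * g U =
      ∑ v ∈ S ∩ H, ∑ w ∈ (S ∩ H) \ {v, π v},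
        α v * α w * ∑ W ∈ shellIn π (del2 π S v w) t c, g (insert v (insert w W)) := by
  calc ∑ U ∈ shellIn π S (t + 2) (c + 2), (∑ v ∈ S ∩ H, ∑ w ∈ (S ∩ H) \ {v, π v},
        α v * α w * ((if (v ∈ U ∧ π v ∉ U) then (1 : ℝ) else 0) * (if (w ∈ U ∧ π w ∉ U) then (1 : ℝ) else 0))) * g U
      = ∑ U ∈ shellIn π S (t + 2) (c + 2), ∑ v ∈ S ∩ H, ∑ w ∈ (S ∩ H) \ {v, π v},
          α v * α w * ((if (v ∈ U ∧ π v ∉ U) then (1 : ℝ) else 0) * (if (w ∈ U ∧ π w ∉ U) then (1 : ℝ) else 0) * g U) := by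
        refine sum_congr rfl fun U _ => ?_
        rw [sum_mul]
        refine sum_congr rfl fun v _ => ?_
        rw [sum_mul]
        exact sum_congr rfl fun w _ => by ring
    _ = ∑ v ∈ S ∩ H, ∑ U ∈ shellIn π S (t + 2) (c + 2), ∑ w ∈ (S ∩ H) \ {v, π v},
          α v * α w * ((if (v ∈ U ∧ π v ∉ U) then (1 : ℝ) else 0) * (if (w ∈ U ∧ π w ∉ U) then (1 : ℝ) else 0) * g U) :=
        sum_comm
    _ = ∑ v ∈ S ∩ H, ∑ w ∈ (S ∩ H) \ {v, π v}, ∑ U ∈ shellIn π S (t + 2) (c + 2),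
          α v * α w * ((if (v ∈ U ∧ π v ∉ U) then (1 : ℝ) else 0) * (if (w ∈ U ∧ π w ∉ U) then (1 : ℝ) else 0) * g U) :=
        sum_congr rfl fun v _ => sum_comm
    _ = _ := by
        refine sum_congr rfl fun v hv => sum_congr rfl fun w hw => ?_
        obtain ⟨hwSH, hwe⟩ := mem_sdiff.1 hw
        rw [mem_insert, mem_singleton, not_or] at hwe
        rw [← mul_sum, ← sum_shellIn_half_half_eq hπ hπ' (mem_inter.1 hv).1 (mem_inter.1 hwSH).1 hwe.1 hwe.2 t c g, sum_filter]
        congr 1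
        refine sum_congr rfl fun U _ => ?_
        by_cases h1 : v ∈ U ∧ π v ∉ U
        · by_cases h2 : w ∈ U ∧ π w ∉ U
          · rw [if_pos h1, if_pos h2, if_pos ⟨h1, h2⟩]; ring
          · rw [if_neg h2, if_neg (show ¬((v ∈ U ∧ π v ∉ U) ∧ (w ∈ U ∧ π w ∉ U)) from fun h => h2 h.2)]; ring
        · rw [if_neg h1, if_neg (show ¬((v ∈ U ∧ π v ∉ U) ∧ (w ∈ U ∧ π w ∉ U)) from fun h => h1 h.1)]; ring

/-- **Weighted half-pair average**: for a stable `S` and `Shell_S(t+2,c+2) ≠ ∅`,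
`E_{Shell_S(t+2,c+2)}[(Σ_vΣ_w α_vα_w[v half][w half])·g] = ((c+2)(c+1)/(|S|(|S|−2)))·Σ_vΣ_w α_vα_w·E_{Shell_{S∖e_v∖e_w}(t,c)}[g(W+w+v)]`.
[cite: Rothvoss2017, §2 (PDF p. 6)] -/
theorem shellInAvg_wHalfPairs_mul_eq {S : Finset (Fin n)} (hS : ∀ u ∈ S, π u ∈ S) (H : Finset (Fin n)) (t c : ℕ)
    (α : Fin n → ℝ) (g : Finset (Fin n) → ℝ) (hne : (shellIn π S (t + 2) (c + 2)).Nonempty) :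
    (∑ U ∈ shellIn π S (t + 2) (c + 2), (∑ v ∈ S ∩ H, ∑ w ∈ (S ∩ H) \ {v, π v},
        α v * α w * ((if (v ∈ U ∧ π v ∉ U) then (1 : ℝ) else 0) * (if (w ∈ U ∧ π w ∉ U) then (1 : ℝ) else 0))) * g U) /
        ((shellIn π S (t + 2) (c + 2)).card : ℝ) =
      ((((c : ℝ) + 2) * ((c : ℝ) + 1)) / ((S.card : ℝ) * ((S.card : ℝ) - 2))) *
        ∑ v ∈ S ∩ H, ∑ w ∈ (S ∩ H) \ {v, π v},
          α v * α w * ((∑ W ∈ shellIn π (del2 π S v w) t c, g (insert v (insert w W))) /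
            ((shellIn π (del2 π S v w) t c).card : ℝ)) := by
  rw [sum_shellIn_wHalfPairs_mul_eq hπ hπ' S H t c α g, sum_div, mul_sum]
  refine sum_congr rfl fun v hv => ?_
  rw [sum_div, mul_sum]
  refine sum_congr rfl fun w hw => ?_
  have hvS : v ∈ S := (mem_inter.1 hv).1
  obtain ⟨hwSH, hwe⟩ := mem_sdiff.1 hw
  rw [mem_insert, mem_singleton, not_or] at hwe
  have hwS : w ∈ S := (mem_inter.1 hwSH).1
  have hr := card_shellIn_del2_half_ratio hπ hπ' hS hvS hwS hwe.1 hwe.2 t c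
  have hS4 : t + 2 + (c + 2) ≤ S.card := by obtain ⟨U, hU⟩ := hne; exact add_le_of_mem_shellIn hπ hS hU
  have h4 : (4 : ℝ) ≤ S.card := by exact_mod_cast (show 4 ≤ S.card by omega)
  have hden : 0 < (S.card : ℝ) * ((S.card : ℝ) - 2) := mul_pos (by linarith) (by linarith)
  have hA : (0 : ℝ) < (shellIn π S (t + 2) (c + 2)).card := by exact_mod_cast hne.card_pos
  have hB : (0 : ℝ) < (shellIn π (del2 π S v w) t c).card := by
    exact_mod_cast (shellIn_del2_nonempty_of_half hπ hπ' hS hvS hwS hwe.1 hwe.2 hne).card_pos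
  have key : (∑ W ∈ shellIn π (del2 π S v w) t c, g (insert v (insert w W))) / ((shellIn π S (t + 2) (c + 2)).card : ℝ) =
      ((((c : ℝ) + 2) * ((c : ℝ) + 1)) / ((S.card : ℝ) * ((S.card : ℝ) - 2))) *
        ((∑ W ∈ shellIn π (del2 π S v w) t c, g (insert v (insert w W))) / ((shellIn π (del2 π S v w) t c).card : ℝ)) := by
    rw [div_mul_div_comm, div_eq_div_iff hA.ne' (mul_ne_zero hden.ne' hB.ne')]
    linear_combination (∑ W ∈ shellIn π (del2 π S v w) t c, g (insert v (insert w W))) * hr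
  rw [mul_div_assoc, key]
  ring

omit hπ hπ' in
/-- The in-set after pinning a block vertex: `(W + v) ∩ H = (W ∩ H) + v` for `v ∈ H`. [folklore] -/
theorem insert_inter_of_mem' {H W : Finset (Fin n)} {v : Fin n} (hv : v ∈ H) : insert v W ∩ H = insert v (W ∩ H) := by
  classical
  rw [insert_inter_of_mem hv]

/-- **`E[(Σ_v α_vY_v)·Φ(U∩H)]`, all levels** (`t' ≥ 1`; the shell nonempty when `c' ≥ 1`):
`= (c'/|S|)·Σ_{v∈S∩H} α_v·E_{Shell_{S∖e_v}(t'−1,c'−1)}[Φ((W∩H)+v)]`. [cite: Rothvoss2017, §2 (PDF p. 6)] -/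
theorem avg_wHalf_junta_eq {S : Finset (Fin n)} (hS : ∀ u ∈ S, π u ∈ S) (H : Finset (Fin n))
    {t' : ℕ} (ht' : 1 ≤ t') (c' : ℕ) (α : Fin n → ℝ) (Φ : Finset (Fin n) → ℝ) (hne : 1 ≤ c' → (shellIn π S t' c').Nonempty) :
    (∑ U ∈ shellIn π S t' c', (∑ v ∈ S ∩ H, α v * (if (v ∈ U ∧ π v ∉ U) then (1 : ℝ) else 0)) * Φ (U ∩ H)) /
        ((shellIn π S t' c').card : ℝ) =
      ((c' : ℝ) / (S.card : ℝ)) * ∑ v ∈ S ∩ H,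
        α v * ((∑ W ∈ shellIn π (S \ {v, π v}) (t' - 1) (c' - 1), (fun J => Φ (insert v J)) (W ∩ H)) /
          ((shellIn π (S \ {v, π v}) (t' - 1) (c' - 1)).card : ℝ)) := by
  classical
  rcases Nat.eq_zero_or_pos c' with rfl | hc
  · have h0 : ∀ U ∈ shellIn π S t' 0,
        (∑ v ∈ S ∩ H, α v * (if (v ∈ U ∧ π v ∉ U) then (1 : ℝ) else 0)) * Φ (U ∩ H) = 0 := by
      intro U hU
      have h := (mem_shellIn.1 hU).2.2
      rw [card_eq_zero] at h
      have hz : ∀ v ∈ S ∩ H, α v * (if (v ∈ U ∧ π v ∉ U) then (1 : ℝ) else 0) = 0 := by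
        intro v _
        have : ¬ (v ∈ U ∧ π v ∉ U) := fun hv => by
          have : v ∈ half π U := mem_half.2 hv
          rw [h] at this; exact notMem_empty v this
        rw [if_neg this, mul_zero]
      rw [sum_congr rfl hz, sum_const_zero, zero_mul]
    rw [sum_congr rfl h0, sum_const_zero, zero_div, Nat.cast_zero, zero_div, zero_mul]
  · obtain ⟨t, rfl⟩ : ∃ t, t' = t + 1 := ⟨t' - 1, by omega⟩
    obtain ⟨c, rfl⟩ : ∃ c, c' = c + 1 := ⟨c' - 1, by omega⟩
    rw [shellInAvg_wHalf_mul_eq hπ hπ' hS H t c α _ (hne hc), Nat.add_sub_cancel, Nat.add_sub_cancel]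
    push_cast
    congr 1
    refine sum_congr rfl fun v hv => ?_
    congr 2
    refine sum_congr rfl fun W _ => ?_
    simp only [insert_inter_of_mem' (mem_inter.1 hv).2]

/-- **`E[(Σ_vΣ_w α_vα_wY_vY_w)·Φ(U∩H)]`, all levels** (`t' ≥ 2`; the shell nonempty when `c' ≥ 2`):
`= (c'(c'−1)/(|S|(|S|−2)))·Σ_vΣ_{w∈(S∩H)∖e_v} α_vα_w·E_{Shell_{S∖e_v∖e_w}(t'−2,c'−2)}[Φ((W∩H)+w+v)]`. [cite: Rothvoss2017, §2 (PDF p. 6)] -/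
theorem avg_wHalfPairs_junta_eq {S : Finset (Fin n)} (hS : ∀ u ∈ S, π u ∈ S) (H : Finset (Fin n))
    {t' : ℕ} (ht' : 2 ≤ t') (c' : ℕ) (α : Fin n → ℝ) (Φ : Finset (Fin n) → ℝ) (hne : 2 ≤ c' → (shellIn π S t' c').Nonempty) :
    (∑ U ∈ shellIn π S t' c', (∑ v ∈ S ∩ H, ∑ w ∈ (S ∩ H) \ {v, π v},
        α v * α w * ((if (v ∈ U ∧ π v ∉ U) then (1 : ℝ) else 0) * (if (w ∈ U ∧ π w ∉ U) then (1 : ℝ) else 0))) *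
          Φ (U ∩ H)) / ((shellIn π S t' c').card : ℝ) =
      (((c' : ℝ) * ((c' : ℝ) - 1)) / ((S.card : ℝ) * ((S.card : ℝ) - 2))) * ∑ v ∈ S ∩ H, ∑ w ∈ (S ∩ H) \ {v, π v},
        α v * α w * ((∑ W ∈ shellIn π (del2 π S v w) (t' - 2) (c' - 2), (fun J => Φ (insert v (insert w J))) (W ∩ H)) /
          ((shellIn π (del2 π S v w) (t' - 2) (c' - 2)).card : ℝ)) := by
  classical
  rcases lt_or_ge c' 2 with hc | hc
  · -- at most one half vertex: the pair indicator vanishes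
    have h0 : ∀ U ∈ shellIn π S t' c', (∑ v ∈ S ∩ H, ∑ w ∈ (S ∩ H) \ {v, π v},
        α v * α w * ((if (v ∈ U ∧ π v ∉ U) then (1 : ℝ) else 0) * (if (w ∈ U ∧ π w ∉ U) then (1 : ℝ) else 0))) *
          Φ (U ∩ H) = 0 := by
      intro U hU
      have h := (mem_shellIn.1 hU).2.2
      have hz : ∀ v ∈ S ∩ H, ∀ w ∈ (S ∩ H) \ {v, π v},
          α v * α w * ((if (v ∈ U ∧ π v ∉ U) then (1 : ℝ) else 0) * (if (w ∈ U ∧ π w ∉ U) then (1 : ℝ) else 0)) = 0 := by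
        intro v _ w hw
        by_cases h1 : v ∈ U ∧ π v ∉ U
        · by_cases h2 : w ∈ U ∧ π w ∉ U
          · exfalso
            have hvw : w ≠ v := by
              rw [mem_sdiff, mem_insert, mem_singleton, not_or] at hw; exact hw.2.1
            have hsub : ({v, w} : Finset (Fin n)) ⊆ half π U := by
              intro u hu
              rcases mem_insert.1 hu with rfl | hu
              · exact mem_half.2 h1
              · rw [mem_singleton] at hu; rw [hu]; exact mem_half.2 h2
            have := card_le_card hsub
            rw [card_pair hvw.symm] at this; omega
          · rw [if_neg h2]; ring
        · rw [if_neg h1]; ring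
      rw [sum_congr rfl fun v hv => sum_congr rfl (hz v hv), sum_congr rfl fun v _ => sum_const_zero, sum_const_zero, zero_mul]
    rw [sum_congr rfl h0, sum_const_zero, zero_div]
    have hzc : (c' : ℝ) * ((c' : ℝ) - 1) = 0 := by interval_cases c' <;> simp
    rw [hzc, zero_div, zero_mul]
  · obtain ⟨t, rfl⟩ : ∃ t, t' = t + 2 := ⟨t' - 2, by omega⟩
    obtain ⟨c, rfl⟩ : ∃ c, c' = c + 2 := ⟨c' - 2, by omega⟩
    rw [shellInAvg_wHalfPairs_mul_eq hπ hπ' hS H t c α _ (hne hc), Nat.add_sub_cancel, Nat.add_sub_cancel]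
    push_cast
    rw [show ((c : ℝ) + 2) * ((c : ℝ) + 2 - 1) = ((c : ℝ) + 2) * ((c : ℝ) + 1) by ring]
    congr 1
    refine sum_congr rfl fun v hv => sum_congr rfl fun w hw => ?_
    congr 2
    refine sum_congr rfl fun W _ => ?_
    have hwH : w ∈ H := (mem_inter.1 (mem_sdiff.1 hw).1).2
    simp only [insert_inter_of_mem' (mem_inter.1 hv).2, insert_inter_of_mem' hwH]

end HalfAvg

end Summit.PneNP.PneNP.Theorems.ChebyshevTracialDesignTiltedJuntaTools

end
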